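import Mathlib.Combinatorics.Matroid.IndepAxioms
import Mathlib.Combinatorics.Matroid.Rank.ENat
import Mathlib.LinearAlgebra.LinearIndependent.Lemmas
import Mathlib.LinearAlgebra.Dimension.Constructions
import HarnessLib

/-!
# The vector (linear, representable) matroid of a family of vectors

For a family of vectors `v : ι → W` in a vector space over a division ring `K` and a ground set
`E : Set ι`, the **vector matroid** `vectorMatroid K v E` on `ι` has ground set `E` and
independent sets the subsets `I ⊆ E` on which the family is linearly independent
(`LinearIndepOn K v I`); parallel indices carrying the same vector are dependent, as they should
be (Oxley, *Matroid Theory*, §1.1, Prop. 1.1.1: the columns of a matrix over a field form a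
matroid; Whitney 1935). Mathlib at this pin has the abstract `Matroid`, the algebraic matroid
`AlgebraicIndependent.matroid`, and all the linear-independence lemmas used here, but not this
construction; it is needed for the cycle matroid of a multigraph (incidence vectors) behind the
Hepp bound (`Literature/Combinatorics/Matroid/HeppBound.lean`).

## Contents (namespace `Literature.Combinatorics.Matroid`)

* `vectorMatroid K v E : Matroid ι` (via `IndepMatroid.ofFinitary`: augmentation from the span
  criterion `linearIndepOn_insert`, compactness from `linearIndepOn_of_finite`), with
  `vectorMatroid_ground`, `vectorMatroid_indep_iff`, finitarity.
* `span_image_eq_of_isBasis` — a matroid basis `I` of `X` spans: `span (v '' X) = span (v '' I)`.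
* `eRk_vectorMatroid_eq_finrank_span` — for finite `X ⊆ E`, the rank of `X` is
  `finrank K (span K (v '' X))` (rank = dimension of the span, Oxley §1.1).

## References

* J. Oxley, *Matroid Theory*, 2nd ed., OUP 2011, §1.1 (Prop. 1.1.1, vector matroids `M[A]`).
-/

noncomputable section

open Set Submodule

namespace Literature.Combinatorics.Matroid

section VectorMatroid

variable {ι K W : Type*} [DivisionRing K] [AddCommGroup W] [Module K W]

/-- **The vector matroid** of the family `v : ι → W` on the ground set `E ⊆ ι`: `I` is independent
iff `I ⊆ E` and `v` is linearly independent on `I` (Oxley, Prop. 1.1.1; for the columns of a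
matrix `A` this is `M[A]`). [folklore] -/
def vectorMatroid (K : Type*) [DivisionRing K] [Module K W] (v : ι → W) (E : Set ι) :
    Matroid ι :=
  IndepMatroid.matroid <|
    IndepMatroid.ofFinitary E (fun I => I ⊆ E ∧ LinearIndepOn K v I)
      ⟨empty_subset _, linearIndepOn_empty K v⟩
      (fun _ _ hJ hIJ => ⟨hIJ.trans hJ.1, hJ.2.mono hIJ⟩)
      (by
        rintro I B ⟨hIE, hI⟩ hInotmax hBmax
        -- `I` is not maximal: some `y ∉ I` keeps `insert y I` independent
        obtain ⟨y, hyE, hyI, hy⟩ : ∃ y, y ∈ E ∧ y ∉ I ∧ v y ∉ span K (v '' I) := by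
          by_contra hcon
          refine hInotmax ⟨⟨hIE, hI⟩, fun J hJ hIJ x hxJ => ?_⟩
          by_contra hxI
          have hins : LinearIndepOn K v (insert x I) := hJ.2.mono (insert_subset hxJ hIJ)
          exact hcon ⟨x, hJ.1 hxJ, hxI, ((linearIndepOn_insert hxI).1 hins).2⟩
        by_contra hcon
        -- then every vector of `B` lies in the span of `v '' I`
        have hB_span : ∀ x ∈ B, v x ∈ span K (v '' I) := by
          intro x hxB
          by_cases hxI : x ∈ I
          · exact subset_span (mem_image_of_mem v hxI)
          · by_contra hx
            exact hcon ⟨x, ⟨hxB, hxI⟩, insert_subset (hBmax.1.1 hxB) hIE, hI.insert hx⟩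
        have hspan_le : span K (v '' B) ≤ span K (v '' I) :=
          span_le.2 (by rintro _ ⟨x, hxB, rfl⟩; exact hB_span x hxB)
        by_cases hyB : y ∈ B
        · exact hy (hB_span y hyB)
        · have hvy : v y ∈ span K (v '' B) := by
            by_contra hvy
            have hle := hBmax.2 ⟨insert_subset hyE hBmax.1.1, hBmax.1.2.insert hvy⟩
              (subset_insert y B)
            exact hyB (hle (mem_insert y B))
          exact hy (hspan_le hvy))
      (fun I h => ⟨fun x hx => (h {x} (by simpa using hx) (finite_singleton x)).1 rfl,
        linearIndepOn_of_finite I fun J hJ hfin => (h J hJ hfin).2⟩)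
      (fun _ hI => hI.1)

/-- The ground set of the vector matroid is `E` (definitional). [folklore] -/
@[simp] theorem vectorMatroid_ground (v : ι → W) (E : Set ι) : (vectorMatroid K v E).E = E := rfl

/-- Independence in the vector matroid is linear independence on a subset of `E`. [folklore] -/
@[simp] theorem vectorMatroid_indep_iff (v : ι → W) (E : Set ι) {I : Set ι} :
    (vectorMatroid K v E).Indep I ↔ I ⊆ E ∧ LinearIndepOn K v I := by
  simp [vectorMatroid]

/-- The vector matroid is finitary (linear independence is detected on finite subsets). [folklore] -/
instance vectorMatroid_finitary (v : ι → W) (E : Set ι) : (vectorMatroid K v E).Finitary := by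
  unfold vectorMatroid; infer_instance

/-- A matroid basis `I` of `X` in the vector matroid spans `v '' X`:
`span (v '' X) = span (v '' I)`. [folklore] -/
theorem span_image_eq_of_isBasis (v : ι → W) (E : Set ι) {I X : Set ι}
    (hI : (vectorMatroid K v E).IsBasis I X) : span K (v '' X) = span K (v '' I) := by
  refine le_antisymm (span_le.2 ?_) (span_mono (image_mono hI.subset))
  rintro _ ⟨x, hxX, rfl⟩
  by_cases hxI : x ∈ I
  · exact subset_span (mem_image_of_mem v hxI)
  · have hli : LinearIndepOn K v I := ((vectorMatroid_indep_iff v E).1 hI.indep).2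
    by_contra hx
    have hdep := hI.insert_dep ⟨hxX, hxI⟩
    refine hdep.not_indep ((vectorMatroid_indep_iff v E).2 ⟨?_, hli.insert hx⟩)
    exact insert_subset (hI.subset_ground hxX) hI.indep.subset_ground

/-- **Rank = dimension of the span**: for a finite `X ⊆ E`, the rank of `X` in the vector matroid
is `dim span (v '' X)` (Oxley §1.1). [folklore] -/
theorem eRk_vectorMatroid_eq_finrank_span (v : ι → W) (E : Set ι) {X : Set ι} (hX : X ⊆ E)
    (hfin : X.Finite) :
    (vectorMatroid K v E).eRk X = Module.finrank K (span K (v '' X)) := by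
  obtain ⟨I, hI⟩ := (vectorMatroid K v E).exists_isBasis X hX
  have hIfin : I.Finite := hfin.subset hI.subset
  haveI : Fintype I := hIfin.fintype
  have hli : LinearIndepOn K v I := ((vectorMatroid_indep_iff v E).1 hI.indep).2
  rw [← hI.encard_eq_eRk, span_image_eq_of_isBasis v E hI, image_eq_range,
    finrank_span_eq_card hli, encard_eq_coe_toFinset_card I, toFinset_card]

end VectorMatroid

end Literature.Combinatorics.Matroid
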